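import Mathlib
import HarnessLib
import Summits.ResolutionOfSingularities.ResolutionOfSingularities.Theorems.WildQuotientsWildQuotientResolutionS1aQhTailSection
import Summits.ResolutionOfSingularities.ResolutionOfSingularities.Theorems.WildQuotientsWildQuotientResolutionS1aSymSections

/-!
# S1a — R4c cusp COVER glue: the two RESIDUAL SECTIONS of a producer chart are PINNED ratios (`(u₀′^{n₀}/c)·T(y) = T(x₀^{n₀})`, `(t̂ⁿ/c)·T(y) = T(tⁿ)`)

[OURS · L1 W4.5c · leafhand-res-wildquotients-7 g1] — NOT statements of the manuscript; counted 0; AI-level work, weaker than expert review. Crux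
stmt-ResolutionOfSingularities-17941 `CyclicQuotientFourfolds`, line `s1a-logminvertex` v13 (`stub_reachLowerInFX`), R4c `cusp_killsIn_two` (crux-dir skeleton v2,
`Lines/s1a_logminvertex-R4c-PROGRESS-v2.md` COVER obligation; hand-7 g0 repair census item (b): "`R₀₂`-residual ⊆ `O′₀₁`-residual").

The residual sections `u₀′^{n₀}/c` (✓`QhAbs.qha_residualSection_zero`) and `t̂ⁿ/c` (✓`QhAbs.qha_residualSection_tail`) of the chart ring `R_c` of a cover element
`c = y·T^{dbar}` are ratios of two cover elements of degree `dbar` — `x₀^{n₀}T^{dbar}/c` and `tⁿT^{dbar}/c` — hence satisfy the chart-ring PIN of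
✓`BlowupCharts.residualSection_pin`: `(z/c)·T(y) = T(y′)` with `y′ = x₀^{n₀}` resp. `tⁿ`. Through the pinned chart iso of a producer chart
(✓`symm_mul_appLE_eq_of_pin`) these become the scheme pins `z · π^*y = π^*y′`, so that ✓`BlowupCharts.mem_basicOpen_iff_of_pins` (hand 7, p819487) transports
"residual" between two producer charts of the same point, and ✓`mem_blowupChart_of_mem_basicOpen_of_mul_appLE_eq` places non-residual points in the
neighbouring chart. Abstract setting of ✓QhAbsCover / ✓QhTailSection (`f : Fin 3 → L`, weights `w`, tail `t ∈ 𝒥_sh`).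
* ★ `qha_residualSection_zero_pin`, ★ `qha_residualSection_tail_pin`;
* `qha_coverElement_eq_u'_zero_pow`, `qha_coverElement_eq_tail_pow` — the two residual numerators ARE cover elements (`c′ = x₀^{n₀}T^{dbar} = u₀′^{n₀}`,
  `c′ = tⁿT^{dbar} = t̂ⁿ`), so the residual sections are literally transition sections ✓`transitionSection` towards the (virtual) charts `[x₀^{n₀}]`, `[tⁿ]`.
-/

set_option linter.dupNamespace false

noncomputable section

open Literature.AlgebraicGeometry.Resolution
open scoped LaurentPolynomial
open Summit.ResolutionOfSingularities.ResolutionOfSingularities.Theorems.WildQuotientResolution.S1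
open Summit.ResolutionOfSingularities.ResolutionOfSingularities.Theorems.WildQuotientResolution.S1.CoarseChart
open Summit.ResolutionOfSingularities.ResolutionOfSingularities.Theorems.WildQuotientResolution.S1.ReesBigrading
open Summit.ResolutionOfSingularities.ResolutionOfSingularities.Theorems.WildQuotientResolution.S1.BlowupCharts
open Summit.ResolutionOfSingularities.ResolutionOfSingularities.Theorems.WildQuotientResolution.S1.GameFrame.GModel

namespace Summit.ResolutionOfSingularities.ResolutionOfSingularities.Theorems.WildQuotientResolution.S1.KillCert.QhAbs

variable {L : Type} [CommRing L] (f : Fin 3 → L) (t : L) (w : Fin 3 → ℕ) (sh : ℕ) (ht : t ∈ (weightedFiltration f w).ideal sh)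
  {m : ℕ} (mo : Fin m → ℕ) (𝒜 : (Π j : Fin m, ZMod (mo j)) → AddSubgroup L) [GradedRing 𝒜]

/-- **`x₀^{n₀}·T^{dbar}` is the cover element `u₀′^{n₀}`** (`dbar = w₀·n₀`): the residual numerator of ✓`qha_residualSection_zero` is a cover element.
[OURS · L1 W4.5c · R4c COVER glue] -/
theorem qha_coverElement_eq_u'_zero_pow {dbar : ℕ} (n : ℕ) (hdbar : dbar = w 0 * n) (h0 : f 0 ^ n ∈ 𝒜 0)
    (hmem : (⟨f 0 ^ n, h0⟩ : ↥(𝒜 0)) ∈ (traceFiltration 𝒜 f w).ideal dbar) :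
    coverElement 𝒜 f w dbar ⟨f 0 ^ n, h0⟩ hmem = cobordantAlgebra.u' f w 0 ^ n := by
  subst hdbar
  refine Subtype.ext ?_
  rw [coe_coverElement, SubmonoidClass.coe_pow, cobordantAlgebra.coe_u', mul_pow, ← map_pow, LaurentPolynomial.T_pow]
  push_cast
  ring_nf

/-- **`tⁿ·T^{dbar}` is the cover element `t̂ⁿ`** (`t̂ = t·T^{sh}`, `dbar = sh·n`): the residual numerator of ✓`qha_residualSection_tail` is a cover element.
[OURS · L1 W4.5c · R4c COVER glue] -/
theorem qha_coverElement_eq_tail_pow {dbar : ℕ} (n : ℕ) (hdbar : dbar = sh * n) (htn : t ^ n ∈ 𝒜 0)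
    (hmem : (⟨t ^ n, htn⟩ : ↥(𝒜 0)) ∈ (traceFiltration 𝒜 f w).ideal dbar) :
    coverElement 𝒜 f w dbar ⟨t ^ n, htn⟩ hmem = (⟨_, C_mul_T_mem_cobordantAlgebra _ _ ht⟩ : ↥(cobordantAlgebra f w)) ^ n := by
  subst hdbar
  refine Subtype.ext ?_
  rw [coe_coverElement, SubmonoidClass.coe_pow, mul_pow, ← map_pow, LaurentPolynomial.T_pow]
  push_cast
  ring_nf

/-- ★ **Pin of the `x₀`-residual section**: `(u₀′^{n₀}/c)·T(y) = T(x₀^{n₀})` in the chart ring of `c = y·T^{dbar}` (`dbar = w₀·n₀`), where `T = toChartRing` is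
the structure map `𝒜 0 → R_c`. With the pinned chart iso `E` of a producer chart (✓`symm_mul_appLE_eq_of_pin`) this is the scheme pin
`z₀ · π^*y = π^*(x₀^{n₀})` required by ✓`BlowupCharts.mem_basicOpen_iff_of_pins` / ✓`mem_blowupChart_of_mem_basicOpen_of_mul_appLE_eq`. [OURS · L1 W4.5c · R4c COVER glue] -/
theorem qha_residualSection_zero_pin {dbar : ℕ} (y : ↥(𝒜 0)) (hy : y ∈ (traceFiltration 𝒜 f w).ideal dbar) (n : ℕ) (hdbar : dbar = w 0 * n)
    (h0 : f 0 ^ n ∈ 𝒜 0) :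
    (algebraMap _ (ChartRing 𝒜 f w dbar y hy) (cobordantAlgebra.u' f w 0 ^ n) * IsLocalization.Away.invSelf (coverElement 𝒜 f w dbar y hy)) *
        toChartRing 𝒜 f w dbar y hy y = toChartRing 𝒜 f w dbar y hy ⟨f 0 ^ n, h0⟩ := by
  refine residualSection_pin mo 𝒜 f w y hy _ ⟨f 0 ^ n, h0⟩ (Subtype.ext ?_)
  subst hdbar
  rw [MulMemClass.coe_mul, MulMemClass.coe_mul, SubmonoidClass.coe_pow, cobordantAlgebra.coe_u', coe_coverElement, cobordantAlgebra.coe_algebraMap,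
    cobordantAlgebra.coe_algebraMap, mul_pow, ← map_pow, LaurentPolynomial.T_pow]
  push_cast
  ring_nf

/-- ★ **Pin of the tail residual section**: `(t̂ⁿ/c)·T(y) = T(tⁿ)` in the chart ring of `c = y·T^{dbar}` (`dbar = sh·n`). [OURS · L1 W4.5c · R4c COVER glue] -/
theorem qha_residualSection_tail_pin {dbar : ℕ} (y : ↥(𝒜 0)) (hy : y ∈ (traceFiltration 𝒜 f w).ideal dbar) (n : ℕ) (hdbar : dbar = sh * n)
    (htn : t ^ n ∈ 𝒜 0) :
    (algebraMap _ (ChartRing 𝒜 f w dbar y hy) ((⟨_, C_mul_T_mem_cobordantAlgebra _ _ ht⟩ : ↥(cobordantAlgebra f w)) ^ n) * IsLocalization.Away.invSelf (coverElement 𝒜 f w dbar y hy)) *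
        toChartRing 𝒜 f w dbar y hy y = toChartRing 𝒜 f w dbar y hy ⟨t ^ n, htn⟩ := by
  refine residualSection_pin mo 𝒜 f w y hy _ ⟨t ^ n, htn⟩ (Subtype.ext ?_)
  subst hdbar
  rw [MulMemClass.coe_mul, MulMemClass.coe_mul, SubmonoidClass.coe_pow, coe_coverElement, cobordantAlgebra.coe_algebraMap,
    cobordantAlgebra.coe_algebraMap, mul_pow, ← map_pow, LaurentPolynomial.T_pow]
  push_cast
  ring_nf

/-- **Residual sections of two charts of one cover agree off their common pins** (ring form): in the chart ring of `c = yT^{dbar}`, the `x₀`-residual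
section times the transition section `c′/c` towards a second cover element `c′ = y′T^{dbar}` is the image of the `x₀`-residual numerator over `c′`:
`(u₀′^{n₀}/c) = (c′/c) · (u₀′^{n₀}/c′)` read in `R_c` as `(u₀′^{n₀}/c)·T(y′) = (c′/c)·T(x₀^{n₀})`. [OURS · L1 W4.5c · R4c COVER glue] -/
theorem qha_residualSection_zero_mul_toChartRing {dbar : ℕ} (y : ↥(𝒜 0)) (hy : y ∈ (traceFiltration 𝒜 f w).ideal dbar)
    (y' : ↥(𝒜 0)) (hy' : y' ∈ (traceFiltration 𝒜 f w).ideal dbar) (n : ℕ) (hdbar : dbar = w 0 * n) (h0 : f 0 ^ n ∈ 𝒜 0) :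
    (algebraMap _ (ChartRing 𝒜 f w dbar y hy) (cobordantAlgebra.u' f w 0 ^ n) * IsLocalization.Away.invSelf (coverElement 𝒜 f w dbar y hy)) *
        toChartRing 𝒜 f w dbar y hy y' =
      (algebraMap _ (ChartRing 𝒜 f w dbar y hy) (coverElement 𝒜 f w dbar y' hy') * IsLocalization.Away.invSelf (coverElement 𝒜 f w dbar y hy)) *
        toChartRing 𝒜 f w dbar y hy ⟨f 0 ^ n, h0⟩ := by
  -- both sides are `u₀′^{n₀} · C(y′) / c` in `R_c`
  have e1 : toChartRing 𝒜 f w dbar y hy y' = algebraMap _ (ChartRing 𝒜 f w dbar y hy) (algebraMap L ↥(cobordantAlgebra f w) (y' : L)) := rfl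
  have e2 : toChartRing 𝒜 f w dbar y hy ⟨f 0 ^ n, h0⟩ = algebraMap _ (ChartRing 𝒜 f w dbar y hy) (algebraMap L ↥(cobordantAlgebra f w) (f 0 ^ n)) := rfl
  have key : cobordantAlgebra.u' f w 0 ^ n * algebraMap L ↥(cobordantAlgebra f w) (y' : L) =
      coverElement 𝒜 f w dbar y' hy' * algebraMap L ↥(cobordantAlgebra f w) (f 0 ^ n) := by
    subst hdbar
    refine Subtype.ext ?_
    rw [MulMemClass.coe_mul, MulMemClass.coe_mul, SubmonoidClass.coe_pow, cobordantAlgebra.coe_u', coe_coverElement, cobordantAlgebra.coe_algebraMap,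
      cobordantAlgebra.coe_algebraMap, mul_pow, ← map_pow, LaurentPolynomial.T_pow]
    push_cast
    ring_nf
  rw [e1, e2, mul_right_comm, ← map_mul, key, map_mul, mul_right_comm]

end Summit.ResolutionOfSingularities.ResolutionOfSingularities.Theorems.WildQuotientResolution.S1.KillCert.QhAbs

end
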